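import Literature.NumberTheory.Automorphic.CMPrincipalSeriesSpherical
import Literature.NumberTheory.Automorphic.UnitaryGroupPrincipalSeriesExponents   -- ★ p825973: `cmWeylTorusCharPair` (§4)
import HarnessLib

/-!
# The exponents `χ_ξ` and `wχ_ξ = (χ̄_ξ,1⁻¹, χ_ξ,2)` of Keys' case (2) on the split torus `A = {d(a, 1, a⁻¹)}` of
# `U(Φ₃)(L⁺_v)`: `|χ_ξ(d(a,1,a⁻¹))| = ‖a‖^{1/2} < 1` and `|wχ_ξ(d(a,1,a⁻¹))| = ‖a‖^{-1/2} > 1` for `‖a‖ < 1`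
(Casselman 1995 Prop. 7.1.3 ∕ Thm 4.4.6 (b) — the hypothesis «`|σ(a)| < 1` for `a ∈ A⁻ ∖ A_∅(𝒪)A_Δ`» CHECKED for Rogawski's `χ_ξ`;
Rogawski 1990 §12.2 (2) pp. 173–174)

Topic `NumberTheory/Automorphic`; namespace `Literature.NumberTheory.Automorphic.UnitaryGroup` (continues ★ `UnitaryGroupBorelInduction`,
★ `CMPrincipalSeriesSpherical`).  THEOREMS ONLY (no definition, no named fact, no instance, no notation, no `sorry`).  Cell
`hodgecm-mathlib`, F0∕P3 topic T3 (Keys NF1 `KeysCaseTwo`): these are the junction lemmas R3∕R4 of the payability map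
`F0/P3/T3b-TREE.md` §1 — the two EXPONENT computations that, fed into Casselman's square-integrability criterion (Thm 4.4.6,
letter N5 of the tree), label the constituents of `i_G(χ_ξ)` as «`π²(ξ)` square-integrable, `πⁿ(ξ)` not» — proved over the
tree's vocabulary only (★ `torusEntry`, `quotConj`, `torusDetNormOne`, `torusCharPair`, `xiTorusChar`∕`cmXiTorusChar`,
`unitModulusChar`, `halfModulusChar`, `IsQuadraticCharExtension`, `glDiagonal_mem_unitaryGroupOfForm_antidiagonal_iff`,
`unitModulusChar_eq_one_of_forall_v_eq_one`).  HC_CM is proved only modulo the printed citations until rung 0 closes; this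
file is unconditional and discharges none of them.

## The print
[Casselman1995] §7.1 p. 67 (rank one, `P = B` maximal): Prop. 7.1.3 «Suppose that `σ|A` is unitary and that `|σ(a)| < 1` for
`a ∈ A⁻ ∖ A_∅(𝒪)A_Δ`. Then any proper subrepresentation `π ⊆ I` is square-integrable mod `Z_G`»; Thm 4.4.6 (b) «for every …
central character `χ` of `π` with respect to `P_Θ`, `|χδ_∅^{-1/2}(a)| < 1` for all `a ∈ A_Θ⁻ ∖ A_∅(𝒪)A_Δ`».  For `G = U(Φ₃)(F)`,
`F = L⁺_v`, `E = L_v = Π_{w∣v} L_w` (non-split `v`: a field): `A_∅ = A = {d(a, 1, a⁻¹) : a ∈ F^×}` (here: torus elements `t`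
with `σ`-FIXED first entry and middle entry `1`; then `t₂₂ = σ(a)⁻¹ = a⁻¹`), `A_Δ = 1` (the centre `E¹` is compact),
`A⁻ ∖ A(𝒪) = {‖a‖ < 1}`.  [Rogawski1990] §12.2 p. 173: «`w(χ₁, χ₂) = (χ̄₁⁻¹, χ₂)`», case (2) «`χ₁(α) = η(α)‖α‖^{1/2}` …
`η|F^* = ω_{E/F}`», p. 174 «`πⁿ(ξ)` is non-tempered»; `χ_ξ = (η̃₁ μ ‖·‖^{1/2}, η₂)` = ★ `cmXiTorusChar L v μ η₁ η₂`.

## What is formalised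
* §1 (generic `R`, involution-free): `quotConj_eq_one_of_map_eq` (`a/σ(a) = 1` for `σ a = a`); `torusDet_eq_one_of_torusEntry`
  (on the `Φ₃`-torus, `σ(t₀₀) = t₀₀` and `t₁₁ = 1` force `det t = 1`); `norm_apply_eq_one_of_isQuadraticCharExtension`
  (`|μ(a)| = 1` on `σ`-fixed units: `μ(a)² = μ(σ(a)·a) = 1`); `exists_torusU_entry_eq` (`d(a, 1, a⁻¹) ∈ T` for `σ`-fixed `a`).
* §2 (the CM local ring `Π_{w∣v} L_w`): `cmXiTorusChar_apply` (unfolding, `rfl`); **`unitModulusChar_lt_one_of_forall_v_lt_one`** —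
  a unit all of whose coordinates lie in the maximal ideals has module `< 1` (Haar: `a·Π𝒪_w` and `1 + a·Π𝒪_w` are disjoint compact
  translates inside `Π𝒪_w`, so `2·‖a‖·μ(Π𝒪_w) ≤ μ(Π𝒪_w)`; companion of ★ `unitModulusChar_eq_one_of_forall_v_eq_one`);
  **`exists_map_eq_unitModulusChar_lt_one`** — the natural number `Nm(v)` is a unit of `Π_{w∣v} L_w` fixed by EVERY ring endomorphism,
  lying in every `w ∣ v` (`Ideal.absNorm_mem`, `HeightOneSpectrum.under`), hence of module `< 1`.
* §3 (the two exponents): **`norm_cmXiTorusChar_lt_one`** — `‖χ_ξ(t)‖ < 1` for `t = d(a,1,a⁻¹)`, `a` `σ`-fixed, `‖a‖ < 1`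
  (value `μ(a)·‖a‖^{1/2}`); **`exists_torusU_one_lt_norm_conj_inv`** — there is such a `t` at which the `w₀`-conjugate character
  `(χ̄_ξ,1⁻¹, η₂)` (★ `torusCharPair … 0 ((χ_ξ,1 ∘ σ)⁻¹) η₂`) has norm `> 1` (value `(μ(a)‖a‖^{1/2})⁻¹`).
* §4 (in the tree's Weyl-conjugate vocabulary ★ `cmWeylTorusCharPair`, R1 of the payability map): **`exists_one_lt_norm_cmWeylTorusCharPair`**
  (§3's witness, restated for `wχ_ξ = cmWeylTorusCharPair L v χ_ξ,1 η₂` — definitionally the same character) and **`cmXiTorusChar_ne_cmWeylTorusCharPair`**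
  — `χ_ξ ≠ wχ_ξ` (the two exponents have norms `< 1` and `> 1` at the same `d(a,1,a⁻¹)`): `χ_ξ` is REGULAR, the input «`πs ≠ πn`» of the
  labelled-pair junction (Casselman Prop. 6.4.1 hypothesis; Rogawski §12.2 «`w(χ₁, χ₂) = (χ̄₁⁻¹, χ₂)`»).

## References
* [Casselman1995] W. Casselman, *Introduction to the theory of admissible representations of p-adic reductive groups*, draft
  1 May 1995, Thm 4.4.6, §7.1 Prop. 7.1.3 p. 67.
* [Rogawski1990] J. D. Rogawski, *Automorphic Representations of Unitary Groups in Three Variables*, Ann. of Math. Stud. 123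
  (1990), §12.1 p. 171, §12.2 (2) pp. 173–174.
* [Keys1984] D. Keys, *Principal series representations of special unitary groups over local fields*, Compositio Math. 51
  (1984) 115–130, §7.
-/

set_option autoImplicit false

noncomputable section

open NumberField IsDedekindDomain MeasureTheory
open scoped NNReal ENNReal Pointwise

namespace Literature.NumberTheory.Automorphic.UnitaryGroup

/-! ## §1 Generic torus bookkeeping on `U(σ, Φ₃)(R)` -/

section Generic

variable {R : Type*} [CommRing R] (σ : R →+* R)

/-- **`a/σ(a) = 1` for a `σ`-fixed unit `a`** (★ `quotConj`): so `η̃₁(a) = η₁(a/ā) = 1` on `F^× ⊂ E^×`.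
[cite: Rogawski1990, §12.1 p. 172] -/
theorem quotConj_eq_one_of_map_eq (hσ : ∀ x : R, σ (σ x) = x) (a : Rˣ) (ha : σ (a : R) = a) :
    quotConj σ hσ a = 1 := by
  apply Subtype.ext
  have hma : Units.map (σ : R →* R) a = a := Units.ext ha
  rw [coe_quotConj, hma, mul_inv_cancel]
  rfl

variable {N : ℕ} in
/-- **On the torus of `U(σ, Φ₃)`: `σ(t₀₀) = t₀₀` and `t₁₁ = 1` force `det t = 1`** (`t = d(a, 1, σ(a)⁻¹) = d(a, 1, a⁻¹)`, the elements of the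
maximal `F`-split torus `A`; ★ `glDiagonal_mem_unitaryGroupOfForm_antidiagonal_iff` gives `σ(t₂₂) t₀₀ = 1`). [cite: Rogawski1990, §1.10 p. 9; §12.1 p. 171] -/
theorem torusDet_eq_one_of_torusEntry (J : Matrix (Fin 3) (Fin 3) R) (hJ : J = (StdForm.antidiagonal 3).over R)
    (t : ↥(torusU σ J)) (hfix : σ ((torusEntry σ J 0 t : Rˣ) : R) = (torusEntry σ J 0 t : Rˣ))
    (h1 : torusEntry σ J 1 t = 1) : torusDet σ J t = 1 := by
  obtain ⟨d, hd⟩ := t.2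
  have hdU : glDiagonal 3 R d ∈ unitaryGroupOfForm σ ((StdForm.antidiagonal 3).over R) := by
    rw [← hJ, hd]; exact (t : ↥(unitaryGroupOfForm σ J)).2
  have hrel := (glDiagonal_mem_unitaryGroupOfForm_antidiagonal_iff σ 3 d).1 hdU
  have h0 : torusEntry σ J 0 t = d 0 := torusEntry_eq_of_glDiagonal_eq σ J 0 t d hd
  have h1' : d 1 = 1 := (torusEntry_eq_of_glDiagonal_eq σ J 1 t d hd).symm.trans h1
  have h2 : (d 0 : R) * d 2 = 1 := by
    have := hrel 2
    have hrev : Fin.rev (2 : Fin 3) = 0 := by decide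
    rw [hrev] at this
    rw [h0] at hfix
    rwa [hfix] at this
  have h2u : d 0 * d 2 = 1 := Units.ext (by rw [Units.val_mul, h2, Units.val_one])
  rw [torusDet_eq_of_glDiagonal_eq σ J t d hd, Fin.prod_univ_three, h1', mul_one, h2u]

/-- **`|μ(a)| = 1` for a `σ`-fixed unit `a` when `μ|F^× = ω_{E/F}`** (★ `IsQuadraticCharExtension`): `a² = σ(a)·a` is a norm, so `μ(a)² = 1`.
[cite: Rogawski1990, §4.8 p. 51; §12.2 p. 173] -/
theorem norm_apply_eq_one_of_isQuadraticCharExtension (μ : Rˣ →* ℂˣ) (hμ : IsQuadraticCharExtension σ μ) (a : Rˣ)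
    (ha : σ (a : R) = a) : ‖((μ a : ℂˣ) : ℂ)‖ = 1 := by
  have hfix2 : σ ((a * a : Rˣ) : R) = (a * a : Rˣ) := by rw [Units.val_mul, map_mul, ha]
  have hμ2 : μ (a * a) = 1 := (hμ (a * a) hfix2).2 ⟨a, by rw [ha, Units.val_mul]⟩
  have hsq : ‖((μ a : ℂˣ) : ℂ)‖ ^ 2 = 1 := by
    rw [← norm_pow, ← Units.val_pow_eq_pow_val, ← map_pow, pow_two, hμ2, Units.val_one, norm_one]
  exact (pow_eq_one_iff_of_nonneg (norm_nonneg _) two_ne_zero).1 hsq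

/-- **The split-torus element `d(a, 1, a⁻¹) ∈ T(Φ₃)` for a `σ`-fixed unit `a`** (Casselman's `A_∅ = {d(a,1,a⁻¹)}` inside Rogawski's
`M = {d(α, β, ᾱ⁻¹)}`). [cite: Rogawski1990, §1.10 p. 9] [cite: Casselman1995, §7.1 p. 67] -/
theorem exists_torusU_entry_eq (J : Matrix (Fin 3) (Fin 3) R) (hJ : J = (StdForm.antidiagonal 3).over R) (a : Rˣ)
    (ha : σ (a : R) = a) : ∃ t : ↥(torusU σ J), torusEntry σ J 0 t = a ∧ torusEntry σ J 1 t = 1 := by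
  set d : Fin 3 → Rˣ := ![a, 1, a⁻¹] with hd
  have hσinv : σ ((a⁻¹ : Rˣ) : R) = ((a⁻¹ : Rˣ) : R) := by
    have h := congrArg σ a.inv_mul
    rw [map_mul, map_one, ha] at h
    calc σ ((a⁻¹ : Rˣ) : R) = σ ((a⁻¹ : Rˣ) : R) * ((a : R) * ((a⁻¹ : Rˣ) : R)) := by rw [a.mul_inv, mul_one]
      _ = ((a⁻¹ : Rˣ) : R) := by rw [← mul_assoc, h, one_mul]
  have hmem : glDiagonal 3 R d ∈ unitaryGroupOfForm σ J := by
    rw [hJ, glDiagonal_mem_unitaryGroupOfForm_antidiagonal_iff]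
    intro i
    fin_cases i
    · show σ ((d 2 : Rˣ) : R) * (d 0 : R) = 1
      simp only [hd, Matrix.cons_val_zero, Matrix.cons_val_two, Matrix.tail_cons, Matrix.head_cons]
      rw [hσinv, Units.inv_mul]
    · show σ ((d 1 : Rˣ) : R) * (d 1 : R) = 1
      simp [hd]
    · show σ ((d 0 : Rˣ) : R) * (d 2 : R) = 1
      simp only [hd, Matrix.cons_val_zero, Matrix.cons_val_two, Matrix.tail_cons, Matrix.head_cons]
      rw [ha, Units.mul_inv]
  refine ⟨⟨⟨glDiagonal 3 R d, hmem⟩, ⟨d, rfl⟩⟩, ?_, ?_⟩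
  · rw [torusEntry_eq_of_glDiagonal_eq σ J 0 _ d rfl]; rfl
  · rw [torusEntry_eq_of_glDiagonal_eq σ J 1 _ d rfl]; rfl

end Generic

/-! ## §2 The CM local ring `L ⊗ L⁺_v = Π_{w ∣ v} L_w`: unfolding `χ_ξ`, units of module `< 1` -/

section CM

variable (L : Type) [Field L] [NumberField L] [IsCMField L] (v : HeightOneSpectrum (𝓞 ↥(maximalRealSubfield L)))

/-- **Unfolding `χ_ξ(t) = η₁(t₀₀/t̄₀₀) · μ(t₀₀) · ‖t₀₀‖^{1/2} · η₂(det t)`** (★ `cmXiTorusChar` = ★ `xiTorusChar` at the CM data; `rfl`).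
[cite: Rogawski1990, §12.2 p. 174] -/
theorem cmXiTorusChar_apply (μ : (LocalRing L v)ˣ →* ℂˣ)
    (η₁ η₂ : ↥(normOneUnits (conjLocal L (IsCMField.complexConj L) v)) →* ℂˣ)
    (t : ↥(torusU (conjLocal L (IsCMField.complexConj L) v) (cmLocalForm L 3 v))) :
    cmXiTorusChar L v μ η₁ η₂ t =
      η₁ (quotConj (conjLocal L (IsCMField.complexConj L) v) (conjLocal_conjLocal_cm L v)
          (torusEntry (conjLocal L (IsCMField.complexConj L) v) (cmLocalForm L 3 v) 0 t)) *
        μ (torusEntry (conjLocal L (IsCMField.complexConj L) v) (cmLocalForm L 3 v) 0 t) *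
        halfModulusChar (LocalRing L v) (torusEntry (conjLocal L (IsCMField.complexConj L) v) (cmLocalForm L 3 v) 0 t) *
        η₂ (torusDetNormOne (conjLocal L (IsCMField.complexConj L) v) (cmLocalForm L 3 v) (cmLocalForm_eq_over L 3 v) t) :=
  rfl

omit [IsCMField L] in
/-- **`‖a‖ < 1` for a unit `a` of `Π_{w ∣ v} L_w` all of whose coordinates lie in the maximal ideals** (`v(a_w) < 1` for every `w ∣ v`):
`T := a · Π𝒪_w` and its translate `1 + T` are DISJOINT compact subsets of `Π𝒪_w` (on each coordinate `v < 1` on `T`, `v = 1` on `1 + T`) of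
equal Haar measure, so `2 · μ(T) ≤ μ(Π𝒪_w)` while `μ(T) = ‖a‖ · μ(Π𝒪_w)` (Mathlib `distribHaarChar_mul`); hence `‖a‖ ≤ ½ < 1`.  Companion of ★
`unitModulusChar_eq_one_of_forall_v_eq_one`; the print's «`A⁻ ∖ A(𝒪) = {‖a‖ < 1}`». [cite: Casselman1995, Thm 4.4.6 (b), §7.1 p. 67]
[cite: CartierCorvallis1979, §IV.1] -/
theorem unitModulusChar_lt_one_of_forall_v_lt_one (a : (LocalRing L v)ˣ)
    (ha : ∀ w : PlacesOver L v, Valued.v ((a : LocalRing L v) w) < 1) : unitModulusChar (LocalRing L v) a < 1 := by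
  borelize (LocalRing L v)
  set s : Set (LocalRing L v) :=
    Set.pi Set.univ fun w : PlacesOver L v => (w.1.adicCompletionIntegers L : Set (w.1.adicCompletion L)) with hs
  have hso : IsOpen s := isOpen_set_pi Set.finite_univ fun w _ => Valued.isOpen_valuationSubring _
  have hsc : IsCompact s :=
    isCompact_univ_pi fun w => isCompact_iff_compactSpace.2 (compactSpace_adicCompletionIntegers' L w.1)
  have hs0 : (0 : LocalRing L v) ∈ s := fun w _ => (w.1.adicCompletionIntegers L).zero_mem
  have hμ0 : Measure.addHaar s ≠ 0 := (hso.measure_pos Measure.addHaar ⟨0, hs0⟩).ne'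
  -- `T := a • s` has all coordinates of valuation `< 1`
  set T : Set (LocalRing L v) := a • s with hT
  have hTv : ∀ y ∈ T, ∀ w, Valued.v (y w) < 1 := by
    rintro y ⟨x, hx, rfl⟩ w
    have hxw : Valued.v (x w) ≤ 1 := hx w (Set.mem_univ _)
    show Valued.v (((a : LocalRing L v) * x) w) < 1
    rw [Pi.mul_apply, map_mul]
    calc Valued.v ((a : LocalRing L v) w) * Valued.v (x w) ≤ Valued.v ((a : LocalRing L v) w) * 1 :=
          mul_le_mul_right hxw _
      _ < 1 := by rw [mul_one]; exact ha w
  have hTs : T ⊆ s := fun y hy w _ => (hTv y hy w).le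
  -- the translate `T' := 1 + T`
  set T' : Set (LocalRing L v) := (fun y => (1 : LocalRing L v) + y) '' T with hT'
  have hT's : T' ⊆ s := by
    rintro _ ⟨y, hy, rfl⟩ w -
    show Valued.v (((1 : LocalRing L v) + y) w) ≤ 1
    rw [Pi.add_apply, Pi.one_apply, Valuation.map_one_add_of_lt _ (hTv y hy w)]
  have hdisj : Disjoint T T' := by
    obtain ⟨w⟩ : Nonempty (PlacesOver L v) := inferInstance
    refine Set.disjoint_left.2 fun z hz hz' => ?_
    obtain ⟨y, hy, rfl⟩ := hz'
    have h1 : Valued.v (((1 : LocalRing L v) + y) w) = 1 := by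
      rw [Pi.add_apply, Pi.one_apply, Valuation.map_one_add_of_lt _ (hTv y hy w)]
    exact (hTv _ hz w).ne h1
  have hTc : IsCompact T := by
    rw [hT, ← Set.image_smul]
    exact hsc.image (continuous_const_smul _)
  have hT'c : IsCompact T' := hTc.image (continuous_const.add continuous_id)
  have hT'm : MeasurableSet T' := hT'c.isClosed.measurableSet
  have hμT' : Measure.addHaar T' = Measure.addHaar T := by
    rw [hT', Set.image_add_left, measure_preimage_add]
  -- `2 μ(T) ≤ μ(s)` and `μ(T) = ‖a‖ μ(s)`
  have h2 : Measure.addHaar T + Measure.addHaar T ≤ Measure.addHaar s := by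
    calc Measure.addHaar T + Measure.addHaar T = Measure.addHaar T + Measure.addHaar T' := by rw [hμT']
      _ = Measure.addHaar (T ∪ T') := (measure_union hdisj hT'm).symm
      _ ≤ Measure.addHaar s := measure_mono (Set.union_subset hTs hT's)
  have hΔ : (unitModulusChar (LocalRing L v) a : ℝ≥0∞) * Measure.addHaar s = Measure.addHaar T := by
    rw [hT]; exact distribHaarChar_mul (μ := Measure.addHaar) a s
  by_contra hge
  rw [not_lt] at hge
  have hTt : Measure.addHaar T ≠ ⊤ := (lt_of_le_of_lt (measure_mono hTs) hsc.measure_lt_top).ne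
  have hsT : Measure.addHaar s ≤ Measure.addHaar T := by
    calc Measure.addHaar s = 1 * Measure.addHaar s := (one_mul _).symm
      _ ≤ (unitModulusChar (LocalRing L v) a : ℝ≥0∞) * Measure.addHaar s := by
          gcongr; exact_mod_cast hge
      _ = Measure.addHaar T := hΔ
  have hT0 : Measure.addHaar T = 0 := by
    have h' : Measure.addHaar T + Measure.addHaar T ≤ Measure.addHaar T + 0 := by rw [add_zero]; exact h2.trans hsT
    exact nonpos_iff_eq_zero.1 ((ENNReal.add_le_add_iff_left hTt).1 h')
  rw [hT0] at hΔ
  rcases mul_eq_zero.1 hΔ with h | h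
  · exact (distribHaarChar_pos (A := LocalRing L v) (g := a)).ne' (by exact_mod_cast h)
  · exact hμ0 h

omit [IsCMField L] in
/-- **A unit of `Π_{w ∣ v} L_w` of module `< 1` fixed by every ring endomorphism**: the natural number `Nm(v) = #(𝒪_{L⁺}/v)` is non-zero, lies in
`v` (Mathlib `Ideal.absNorm_mem`) hence in every `w ∣ v` (`w ∩ 𝒪_{L⁺} = v`), so all its coordinates have valuation `< 1`
(`valuation_lt_one_iff_mem`, `valuedAdicCompletion_eq_valuation'`); being a natural number it is fixed by `σ` (`map_natCast`).  Supplies an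
`a ∈ A⁻ ∖ A(𝒪)`, i.e. the print's «`A/A_Δ` is one-dimensional» non-vacuously. [cite: Casselman1995, §7.1 p. 67] -/
theorem exists_map_eq_unitModulusChar_lt_one (σ : LocalRing L v →+* LocalRing L v) :
    ∃ a : (LocalRing L v)ˣ, σ (a : LocalRing L v) = a ∧ unitModulusChar (LocalRing L v) a < 1 := by
  set N : ℕ := Ideal.absNorm v.asIdeal with hN
  have hN0 : N ≠ 0 := fun h => v.ne_bot (Ideal.absNorm_eq_zero_iff.1 h)
  have hNL : (N : L) ≠ 0 := Nat.cast_ne_zero.2 hN0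
  have hNw : ∀ w : PlacesOver L v, (N : w.1.adicCompletion L) ≠ 0 := fun w => by
    rw [← map_natCast (algebraMap L (w.1.adicCompletion L)) N]
    exact (map_ne_zero _).2 hNL
  have hmem : ∀ w : PlacesOver L v, (N : 𝓞 L) ∈ w.1.asIdeal := fun w => by
    have h1 : (N : 𝓞 ↥(maximalRealSubfield L)) ∈ v.asIdeal := hN ▸ Ideal.absNorm_mem v.asIdeal
    have h2 : (HeightOneSpectrum.under (𝓞 ↥(maximalRealSubfield L)) w.1).asIdeal = v.asIdeal :=
      congrArg HeightOneSpectrum.asIdeal w.2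
    rw [← h2, HeightOneSpectrum.under_asIdeal, Ideal.under_def, Ideal.mem_comap, map_natCast] at h1
    exact h1
  have hval : ∀ w : PlacesOver L v, Valued.v ((N : LocalRing L v) w) < 1 := fun w => by
    rw [Pi.natCast_apply, ← map_natCast (algebraMap L (w.1.adicCompletion L)) N,
      ← map_natCast (algebraMap (𝓞 L) L) N]
    have := (HeightOneSpectrum.valuation_lt_one_iff_mem (K := L) w.1 (N : 𝓞 L)).2 (hmem w)
    rwa [← HeightOneSpectrum.valuedAdicCompletion_eq_valuation' (K := L) w.1] at this
  refine ⟨⟨(N : LocalRing L v), fun w => ((N : w.1.adicCompletion L))⁻¹, ?_, ?_⟩, ?_, ?_⟩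
  · funext w; rw [Pi.mul_apply, Pi.natCast_apply, Pi.one_apply, mul_inv_cancel₀ (hNw w)]
  · funext w; rw [Pi.mul_apply, Pi.natCast_apply, Pi.one_apply, inv_mul_cancel₀ (hNw w)]
  · exact map_natCast σ N
  · exact unitModulusChar_lt_one_of_forall_v_lt_one L v _ hval

/-! ## §3 The two exponents of Keys' case (2) on `A⁻ ∖ A(𝒪)` -/

/-- **The exponent `χ_ξ = (η̃₁ μ ‖·‖^{1/2}, η₂)` DECAYS on `A⁻`**: for `t ∈ T` with `σ`-fixed first entry `a = t₀₀`, middle entry `1` and `‖a‖ < 1`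
(i.e. `t = d(a, 1, a⁻¹)`, `a ∈ F^×`, `a ∈ A⁻ ∖ A(𝒪)`), `‖χ_ξ(t)‖ = |η₁(a/ā)|·|μ(a)|·‖a‖^{1/2}·|η₂(det t)| = ‖a‖^{1/2} < 1` — Casselman's hypothesis
«`|σ(a)| < 1` for `a ∈ A⁻ ∖ A_∅(𝒪)A_Δ`» of Prop. 7.1.3 for Rogawski's `χ_ξ`, whence (Thm 4.4.6) the constituent with exponent `χ_ξ` is `π²(ξ)`.
[cite: Casselman1995, Prop. 7.1.3, Thm 4.4.6 (b)] [cite: Rogawski1990, §12.2 (2) pp. 173–174] -/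
theorem norm_cmXiTorusChar_lt_one (μ : (LocalRing L v)ˣ →* ℂˣ)
    (η₁ η₂ : ↥(normOneUnits (conjLocal L (IsCMField.complexConj L) v)) →* ℂˣ)
    (hμ : IsQuadraticCharExtension (conjLocal L (IsCMField.complexConj L) v) μ)
    (t : ↥(torusU (conjLocal L (IsCMField.complexConj L) v) (cmLocalForm L 3 v)))
    (hfix : conjLocal L (IsCMField.complexConj L) v
        ((torusEntry (conjLocal L (IsCMField.complexConj L) v) (cmLocalForm L 3 v) 0 t : (LocalRing L v)ˣ) : LocalRing L v) =
      (torusEntry (conjLocal L (IsCMField.complexConj L) v) (cmLocalForm L 3 v) 0 t : (LocalRing L v)ˣ))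
    (h1 : torusEntry (conjLocal L (IsCMField.complexConj L) v) (cmLocalForm L 3 v) 1 t = 1)
    (hm : unitModulusChar (LocalRing L v) (torusEntry (conjLocal L (IsCMField.complexConj L) v) (cmLocalForm L 3 v) 0 t) < 1) :
    ‖((cmXiTorusChar L v μ η₁ η₂ t : ℂˣ) : ℂ)‖ < 1 := by
  have hq := quotConj_eq_one_of_map_eq (conjLocal L (IsCMField.complexConj L) v) (conjLocal_conjLocal_cm L v) _ hfix
  have hdet : torusDetNormOne (conjLocal L (IsCMField.complexConj L) v) (cmLocalForm L 3 v) (cmLocalForm_eq_over L 3 v) t = 1 := by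
    apply Subtype.ext
    rw [coe_torusDetNormOne]
    exact torusDet_eq_one_of_torusEntry (conjLocal L (IsCMField.complexConj L) v) (cmLocalForm L 3 v)
      (cmLocalForm_eq_over L 3 v) t hfix h1
  have hμn := norm_apply_eq_one_of_isQuadraticCharExtension (conjLocal L (IsCMField.complexConj L) v) μ hμ _ hfix
  rw [cmXiTorusChar_apply, hq, hdet, map_one, map_one, one_mul, mul_one, Units.val_mul, norm_mul, hμn, one_mul,
    coe_halfModulusChar_apply, Complex.norm_real, Real.norm_eq_abs, NNReal.abs_eq, NNReal.coe_lt_one]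
  have hlt := NNReal.sqrt_lt_sqrt.2 hm
  rwa [NNReal.sqrt_one] at hlt

/-- **The `w₀`-conjugate exponent `wχ_ξ = (χ̄_ξ,1⁻¹, η₂)` GROWS somewhere on `A⁻ ∖ A(𝒪)`**: there is `t = d(a, 1, a⁻¹) ∈ T` (`a` `σ`-fixed, `‖a‖ < 1`;
`a = Nm(v)`) at which the character `d ↦ (χ_ξ,1(σ(d₀₀)))⁻¹ · η₂(det d)` (★ `torusCharPair … 0 ((χ_ξ,1 ∘ σ)⁻¹) η₂`, print's `w(χ₁, χ₂) = (χ̄₁⁻¹, χ₂)`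
applied to `χ_ξ`) has norm `‖a‖^{-1/2} > 1`; so `wχ_ξ` violates Casselman's condition (b) and the constituent with exponent `wχ_ξ` — `πⁿ(ξ)` — is NOT
square-integrable («`πⁿ(ξ)` is non-tempered»). [cite: Casselman1995, Thm 4.4.6 (b), §7.1 p. 67] [cite: Rogawski1990, §12.2 (2) pp. 173–174] -/
theorem exists_torusU_one_lt_norm_conj_inv (μ : (LocalRing L v)ˣ →* ℂˣ)
    (η₁ η₂ : ↥(normOneUnits (conjLocal L (IsCMField.complexConj L) v)) →* ℂˣ)
    (hμ : IsQuadraticCharExtension (conjLocal L (IsCMField.complexConj L) v) μ) :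
    ∃ t : ↥(torusU (conjLocal L (IsCMField.complexConj L) v) (cmLocalForm L 3 v)),
      conjLocal L (IsCMField.complexConj L) v
          ((torusEntry (conjLocal L (IsCMField.complexConj L) v) (cmLocalForm L 3 v) 0 t : (LocalRing L v)ˣ) : LocalRing L v) =
        (torusEntry (conjLocal L (IsCMField.complexConj L) v) (cmLocalForm L 3 v) 0 t : (LocalRing L v)ˣ) ∧
      torusEntry (conjLocal L (IsCMField.complexConj L) v) (cmLocalForm L 3 v) 1 t = 1 ∧
      unitModulusChar (LocalRing L v) (torusEntry (conjLocal L (IsCMField.complexConj L) v) (cmLocalForm L 3 v) 0 t) < 1 ∧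
      1 < ‖((torusCharPair (conjLocal L (IsCMField.complexConj L) v) (cmLocalForm L 3 v) (cmLocalForm_eq_over L 3 v) 0
              ((η₁.comp (quotConj (conjLocal L (IsCMField.complexConj L) v) (conjLocal_conjLocal_cm L v)) * μ *
                  halfModulusChar (LocalRing L v)).comp (Units.map (conjLocal L (IsCMField.complexConj L) v).toMonoidHom))⁻¹ η₂ t : ℂˣ) : ℂ)‖ := by
  obtain ⟨a, hfix, hm⟩ := exists_map_eq_unitModulusChar_lt_one L v (conjLocal L (IsCMField.complexConj L) v)
  obtain ⟨t, ht0, ht1⟩ := exists_torusU_entry_eq (conjLocal L (IsCMField.complexConj L) v) (cmLocalForm L 3 v)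
    (cmLocalForm_eq_over L 3 v) a hfix
  have hfix' : conjLocal L (IsCMField.complexConj L) v
      ((torusEntry (conjLocal L (IsCMField.complexConj L) v) (cmLocalForm L 3 v) 0 t : (LocalRing L v)ˣ) : LocalRing L v) =
      (torusEntry (conjLocal L (IsCMField.complexConj L) v) (cmLocalForm L 3 v) 0 t : (LocalRing L v)ˣ) := by
    rw [ht0]; exact hfix
  have hm' : unitModulusChar (LocalRing L v) (torusEntry (conjLocal L (IsCMField.complexConj L) v) (cmLocalForm L 3 v) 0 t) < 1 := by
    rw [ht0]; exact hm
  refine ⟨t, hfix', ht1, hm', ?_⟩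
  have hma : Units.map (conjLocal L (IsCMField.complexConj L) v).toMonoidHom a = a := Units.ext hfix
  have hq := quotConj_eq_one_of_map_eq (conjLocal L (IsCMField.complexConj L) v) (conjLocal_conjLocal_cm L v) a hfix
  have hdet : torusDetNormOne (conjLocal L (IsCMField.complexConj L) v) (cmLocalForm L 3 v) (cmLocalForm_eq_over L 3 v) t = 1 := by
    apply Subtype.ext
    rw [coe_torusDetNormOne]
    exact torusDet_eq_one_of_torusEntry (conjLocal L (IsCMField.complexConj L) v) (cmLocalForm L 3 v)
      (cmLocalForm_eq_over L 3 v) t hfix' ht1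
  have hval : torusCharPair (conjLocal L (IsCMField.complexConj L) v) (cmLocalForm L 3 v) (cmLocalForm_eq_over L 3 v) 0
      ((η₁.comp (quotConj (conjLocal L (IsCMField.complexConj L) v) (conjLocal_conjLocal_cm L v)) * μ *
          halfModulusChar (LocalRing L v)).comp (Units.map (conjLocal L (IsCMField.complexConj L) v).toMonoidHom))⁻¹ η₂ t =
      (μ a * halfModulusChar (LocalRing L v) a)⁻¹ := by
    rw [torusCharPair_apply, hdet, map_one, mul_one, MonoidHom.inv_apply, MonoidHom.comp_apply, ht0, hma,
      MonoidHom.mul_apply, MonoidHom.mul_apply, MonoidHom.comp_apply, hq, map_one, one_mul]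
  have hμn := norm_apply_eq_one_of_isQuadraticCharExtension (conjLocal L (IsCMField.complexConj L) v) μ hμ a hfix
  have hpos : 0 < NNReal.sqrt (unitModulusChar (LocalRing L v) a) :=
    NNReal.sqrt_pos.2 (distribHaarChar_pos (A := LocalRing L v) (g := a))
  have hlt1 : NNReal.sqrt (unitModulusChar (LocalRing L v) a) < 1 := by
    have h := NNReal.sqrt_lt_sqrt.2 hm
    rwa [NNReal.sqrt_one] at h
  rw [hval, Units.val_inv_eq_inv_val, norm_inv, Units.val_mul, norm_mul, hμn, one_mul, coe_halfModulusChar_apply,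
    Complex.norm_real, Real.norm_eq_abs, NNReal.abs_eq, ← NNReal.coe_inv, ← NNReal.coe_one, NNReal.coe_lt_coe]
  exact (one_lt_inv₀ hpos).2 hlt1

/-! ## §4 `χ_ξ ≠ wχ_ξ` in the Weyl-conjugate vocabulary (R1) -/

/-- **The growing exponent, by name**: at some `t = d(a, 1, a⁻¹)` (`a` `σ`-fixed, `‖a‖ < 1`) the Weyl conjugate `wχ_ξ = (χ̄_ξ,1⁻¹, η₂)` — ★
`cmWeylTorusCharPair L v (η̃₁ · μ · ‖·‖^{1/2}) η₂`, definitionally §3's `torusCharPair … 0 ((χ_ξ,1 ∘ σ)⁻¹) η₂` — has norm `> 1`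
(`exists_torusU_one_lt_norm_conj_inv` restated). [cite: Rogawski1990, §12.2 (2) p. 174] [cite: Casselman1995, Thm 4.4.6 (b)] -/
theorem exists_one_lt_norm_cmWeylTorusCharPair (μ : (LocalRing L v)ˣ →* ℂˣ)
    (η₁ η₂ : ↥(normOneUnits (conjLocal L (IsCMField.complexConj L) v)) →* ℂˣ)
    (hμ : IsQuadraticCharExtension (conjLocal L (IsCMField.complexConj L) v) μ) :
    ∃ t : ↥(torusU (conjLocal L (IsCMField.complexConj L) v) (cmLocalForm L 3 v)),
      conjLocal L (IsCMField.complexConj L) v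
          ((torusEntry (conjLocal L (IsCMField.complexConj L) v) (cmLocalForm L 3 v) 0 t : (LocalRing L v)ˣ) : LocalRing L v) =
        ((torusEntry (conjLocal L (IsCMField.complexConj L) v) (cmLocalForm L 3 v) 0 t : (LocalRing L v)ˣ) : LocalRing L v) ∧
      torusEntry (conjLocal L (IsCMField.complexConj L) v) (cmLocalForm L 3 v) 1 t = 1 ∧
      unitModulusChar (LocalRing L v) (torusEntry (conjLocal L (IsCMField.complexConj L) v) (cmLocalForm L 3 v) 0 t) < 1 ∧
      1 < ‖((cmWeylTorusCharPair L v
              (η₁.comp (quotConj (conjLocal L (IsCMField.complexConj L) v) (conjLocal_conjLocal_cm L v)) * μ *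
                halfModulusChar (LocalRing L v)) η₂ t : ℂˣ) : ℂ)‖ :=
  exists_torusU_one_lt_norm_conj_inv L v μ η₁ η₂ hμ

/-- **`χ_ξ ≠ wχ_ξ` (R1: Keys' case-(2) character is regular).**  At the witness of `exists_one_lt_norm_cmWeylTorusCharPair`,
`‖χ_ξ(t)‖ < 1` (`norm_cmXiTorusChar_lt_one`) while `‖wχ_ξ(t)‖ > 1`.  Used for «`πs ≠ πn`»: the two constituents of `i_G(χ_ξ)` have the
distinct exponents `χ_ξ`, `wχ_ξ`. [cite: Rogawski1990, §12.2 (2) pp. 173–174] [cite: Casselman1995, Prop. 6.4.1, §7.1] -/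
theorem cmXiTorusChar_ne_cmWeylTorusCharPair (μ : (LocalRing L v)ˣ →* ℂˣ)
    (η₁ η₂ : ↥(normOneUnits (conjLocal L (IsCMField.complexConj L) v)) →* ℂˣ)
    (hμ : IsQuadraticCharExtension (conjLocal L (IsCMField.complexConj L) v) μ) :
    cmXiTorusChar L v μ η₁ η₂ ≠
      cmWeylTorusCharPair L v
        (η₁.comp (quotConj (conjLocal L (IsCMField.complexConj L) v) (conjLocal_conjLocal_cm L v)) * μ *
          halfModulusChar (LocalRing L v)) η₂ := by
  intro h
  obtain ⟨t, hfix, h1, hm, hlt⟩ := exists_one_lt_norm_cmWeylTorusCharPair L v μ η₁ η₂ hμ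
  have hlt1 := norm_cmXiTorusChar_lt_one L v μ η₁ η₂ hμ t hfix h1 hm
  rw [h] at hlt1
  exact absurd hlt1 (not_lt.2 hlt.le)

end CM

end Literature.NumberTheory.Automorphic.UnitaryGroup

end
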